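import Literature.Barriers.Parity.GoldbachAverageZeros
import Literature.NumberTheory.LFunctions.GoldbachAPBilinear
import Literature.NumberTheory.LFunctions.SiegelWalfisz
import Literature.NumberTheory.LFunctions.PagePNTWithExceptionalZeroProofs
import HarnessLib

/-!
# Proof of `BHMS2019_thm1_i` (Bhowmik–Halupczok–Matsumoto–Suzuki 2019, Theorem 1 (1))

Topic `Literature/Barriers/Parity`. Everything in this file is PROVED (theorems only); it discharges
the named fact `Literature.Barriers.Parity.BHMS2019_thm1_i` of `GoldbachAverageZeros.lean`:

  for `(a, q) = (b, q) = 1`, `σ₁ ≥ 1/2` with every non-trivial zero of every `L(s, χ)` (`χ` mod `q`)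
  in `Re s ≤ σ₁`, and `x ≥ 2`:  `|S(x; q, a, b) − x²/(2φ(q)²)| ≤ C x^{1+σ₁}` with `C` absolute.

The printed proof (explicit formula for `ψ(x, χ)` plus Landau–Page) is replaced by a mean-square
argument formalised in `Literature/NumberTheory/LFunctions/GoldbachAPBilinear.lean`
(`Literature.NumberTheory.LFunctions.ResidueRiesz.abs_S2_sub_le`), which controls
`S₂(N) = φ(q)² S(N; q, a, b)` by `C φ N^{1+σ₁}((log q+1) + φ (log q+1)²(log N+1)² N^{-(1−σ₁)/2})`
for `N ≥ 16`, `σ₁ + 4/log N ≤ 1`, any `q`. The remaining ranges are covered here: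
* `σ₁` close to `1` or `x` small: the log-free trivial bound `S₂(N) ≤ ψ(N; Λ_{q,a}) ψ(N; Λ_{q,b})`
  with Chebyshev's `ψ(x) ≤ (log 4 + 4) x` (`abs_S2_sub_le_trivial`);
* `N^{(1−σ₁)/2} < (log q+1)²(log N+1)²` and `φ(q) ≥ N^{(1−σ₁)/2}(log N + 1)`: the trivial bound
  `ψ(N; q, a) ≤ (N/q + 1) log N` (`abs_S2_sub_le_trivial_log`);
* `N^{(1−σ₁)/2} < (log q+1)²(log N+1)²` and `φ(q) < N^{(1−σ₁)/2}(log N+1)`: then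
  `q ≤ K (log N + 1)^{12}` (`√q ≪ φ(q)`), and the Siegel–Walfisz theorem of the tree
  (`Literature.NumberTheory.LFunctions.siegel_walfisz_holds`, exponent `20`) together with the
  log-free bound for `ψ₁` gives `|S₂(N) − N²/2| ≪ φ² N²/(log N + 1)⁸ ≪ φ² N^{1+σ₁}`
  (`abs_S2_sub_le_SW`).
Finally `S₂ = φ(q)² · goldbachLambdaSumMod` (`S2_eq_totient_sq_mul`).

## References

* G. Bhowmik, K. Halupczok, K. Matsumoto, Y. Suzuki, *Goldbach representations in arithmetic
  progressions and zeros of Dirichlet L-functions*, Mathematika 65 (2019), 57–97, Theorem 1 (1)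
  (`BhowmikHalupczokMatsumotoSuzuki2019`).
* H. L. Montgomery, R. C. Vaughan, *Multiplicative Number Theory I*, Cor. 11.19 (Siegel–Walfisz)
  (`MontgomeryVaughan2007`).
-/

noncomputable section

open Real Finset
open scoped ArithmeticFunction.vonMangoldt Chebyshev
open Literature.NumberTheory.LFunctions Literature.NumberTheory.LFunctions.ResidueRiesz

namespace Literature.Barriers.Parity

variable {q : ℕ} [NeZero q]

/-! ### The bridge `S₂ = φ² · S(·; q, a, b)` and `Ψ = φ · ψ(·; q, ·)` -/

omit [NeZero q] in
/-- `Λ_{q,a}(l) = φ(q) Λ(l) 𝟙[l ≡ a (q)]` for natural `a`. [folklore] -/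
theorem Lam_natCast_apply (a l : ℕ) :
    Lam ((a : ZMod q)) l = if l ≡ a [MOD q] then (q.totient : ℝ) * Λ l else 0 := by
  have key : ((l : ZMod q) = (a : ZMod q)) ↔ l ≡ a [MOD q] := ZMod.natCast_eq_natCast_iff l a q
  simp only [Lam, ArithmeticFunction.vonMangoldt.residueClass, Set.indicator_apply, Set.mem_setOf_eq]
  by_cases h : l ≡ a [MOD q]
  · rw [if_pos (key.2 h), if_pos h]
  · rw [if_neg (fun h' ↦ h (key.1 h')), if_neg h, mul_zero]

omit [NeZero q] in
/-- **`S₂(N) = φ(q)² S(N; q, a, b)`.** [folklore] -/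
theorem S2_eq_totient_sq_mul (a b N : ℕ) :
    S2 ((a : ZMod q)) ((b : ZMod q)) N = (q.totient : ℝ) ^ 2 * goldbachLambdaSumMod q a b N := by
  rw [S2, goldbachLambdaSumMod, mul_sum]
  refine sum_congr rfl fun n _ ↦ ?_
  rw [goldbachLambdaCountMod, sum_filter, mul_sum]
  refine sum_congr rfl fun lm _ ↦ ?_
  rw [Lam_natCast_apply, Lam_natCast_apply]
  by_cases h1 : lm.1 ≡ a [MOD q]
  · by_cases h2 : lm.2 ≡ b [MOD q]
    · simp only [h1, h2, and_self, if_true]; ring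
    · simp [h1, h2]
  · simp [h1]

omit [NeZero q] in
/-- `Ψ_c(k) = φ(q) ψ(k; q, c)` (the tree's `Literature.NumberTheory.Sieve.ParityWave0.chebyshevPsiMod`). [folklore] -/
theorem PsiN_eq_totient_mul (c : ZMod q) (k : ℕ) :
    PsiN c k = (q.totient : ℝ) * Literature.NumberTheory.Sieve.ParityWave0.chebyshevPsiMod q c k := by
  rw [PsiN, Literature.NumberTheory.Sieve.ParityWave0.chebyshevPsiMod, Nat.floor_natCast, mul_sum]
  rfl

omit [NeZero q] in
/-- `Ψ_c(N) ≤ φ(q) ψ(N)` with Chebyshev's `ψ`. [folklore] -/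
theorem PsiN_le_totient_mul_psi (c : ZMod q) (N : ℕ) : PsiN c N ≤ (q.totient : ℝ) * ψ (N : ℝ) := by
  rw [PsiN_eq_psi, ClassicalPsiData.psi, Chebyshev.psi, mul_sum]
  exact sum_le_sum fun n _ ↦ Lam_le c n

omit [NeZero q] in
/-- `Ψ_c(N) ≤ φ(q) (log 4 + 4) N`. [folklore] -/
theorem PsiN_le_linear (c : ZMod q) (N : ℕ) : PsiN c N ≤ (q.totient : ℝ) * ((Real.log 4 + 4) * N) :=
  (PsiN_le_totient_mul_psi c N).trans
    (mul_le_mul_of_nonneg_left (Chebyshev.psi_le_const_mul_self (Nat.cast_nonneg N)) (Nat.cast_nonneg _))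

/-! ### Trivial bounds -/

omit [NeZero q] in
/-- **Log-free trivial bound**: `|S₂(N) − N²/2| ≤ (φ(q)²(log 4 + 4)² + 1/2) N²`. [folklore] -/
theorem abs_S2_sub_le_trivial (a b : ZMod q) (N : ℕ) :
    |S2 a b N - (N : ℝ) ^ 2 / 2| ≤ ((q.totient : ℝ) ^ 2 * (Real.log 4 + 4) ^ 2 + 1 / 2) * (N : ℝ) ^ 2 := by
  have h0 := S2_nonneg a b N
  have h1 := S2_le_PsiN_mul a b N
  have ha := PsiN_le_linear a N
  have hb := PsiN_le_linear b N
  have ha0 := PsiN_nonneg a N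
  have hb0 := PsiN_nonneg b N
  have hprod : S2 a b N ≤ ((q.totient : ℝ) * ((Real.log 4 + 4) * N)) ^ 2 := by
    calc S2 a b N ≤ PsiN a N * PsiN b N := h1
      _ ≤ ((q.totient : ℝ) * ((Real.log 4 + 4) * N)) * ((q.totient : ℝ) * ((Real.log 4 + 4) * N)) :=
          mul_le_mul ha hb hb0 (ha0.trans ha)
      _ = _ := by ring
  rw [abs_le]
  constructor <;> nlinarith [sq_nonneg (N : ℝ)]

/-- **Trivial bound with the modulus**: for `N ≥ 1`,
`|S₂(N) − N²/2| ≤ 3 (N² + φ(q)²)(log N + 1)²` (from `ψ(N; q, a) ≤ (N/q + 1) log N`, `φ(q) ≤ q`). [folklore] -/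
theorem abs_S2_sub_le_trivial_log (a b : ZMod q) {N : ℕ} (hN : 1 ≤ N) :
    |S2 a b N - (N : ℝ) ^ 2 / 2| ≤ 3 * ((N : ℝ) ^ 2 + (q.totient : ℝ) ^ 2) * (Real.log N + 1) ^ 2 := by
  have hq : 1 ≤ q := NeZero.pos q
  have hN1 : (1 : ℝ) ≤ N := by exact_mod_cast hN
  have hlog0 : 0 ≤ Real.log N := Real.log_nonneg hN1
  have hφq : (q.totient : ℝ) ≤ q := by exact_mod_cast Nat.totient_le q
  have hφ1 : (1 : ℝ) ≤ q.totient := by exact_mod_cast Nat.succ_le_of_lt (Nat.totient_pos.2 (NeZero.pos q))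
  have hq0 : (0 : ℝ) < q := by exact_mod_cast hq
  have hψ : ∀ c : ZMod q, PsiN c N ≤ ((N : ℝ) + q.totient) * (Real.log N + 1) := by
    intro c
    rw [PsiN_eq_totient_mul]
    have h := PagePNT.chebyshevPsiMod_le_trivial hq c hN1
    have hψ0 : 0 ≤ Literature.NumberTheory.Sieve.ParityWave0.chebyshevPsiMod q c N :=
      sum_nonneg fun n _ ↦ ArithmeticFunction.vonMangoldt.residueClass_nonneg c n
    calc (q.totient : ℝ) * Literature.NumberTheory.Sieve.ParityWave0.chebyshevPsiMod q c N ≤ (q.totient : ℝ) * (((N : ℝ) / q + 1) * Real.log N) :=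
          mul_le_mul_of_nonneg_left h (by linarith)
      _ = ((q.totient : ℝ) / q * N + q.totient) * Real.log N := by ring
      _ ≤ (1 * N + q.totient) * (Real.log N + 1) := by
          have : (q.totient : ℝ) / q ≤ 1 := by rw [div_le_one hq0]; exact hφq
          have hN0 : (0 : ℝ) ≤ N := by linarith
          nlinarith [mul_le_mul_of_nonneg_right this hN0]
      _ = _ := by ring
  have h0 := S2_nonneg a b N
  have h1 := S2_le_PsiN_mul a b N
  have ha0 := PsiN_nonneg a N
  have hb0 := PsiN_nonneg b N
  have hprod : S2 a b N ≤ (((N : ℝ) + q.totient) * (Real.log N + 1)) ^ 2 := by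
    calc S2 a b N ≤ PsiN a N * PsiN b N := h1
      _ ≤ (((N : ℝ) + q.totient) * (Real.log N + 1)) * (((N : ℝ) + q.totient) * (Real.log N + 1)) :=
          mul_le_mul (hψ a) (hψ b) hb0 (ha0.trans (hψ a))
      _ = _ := by ring
  have hL1 : 1 ≤ (Real.log N + 1) ^ 2 := by nlinarith
  rw [abs_le]
  constructor
  · nlinarith [sq_nonneg (N : ℝ), sq_nonneg (q.totient : ℝ)]
  · nlinarith [sq_nonneg ((N : ℝ) - q.totient), sq_nonneg (N : ℝ), sq_nonneg (q.totient : ℝ)]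

/-! ### `φ(q)` versus `log q`, and the size of `q` when `φ(q)` is small -/

omit [NeZero q] in
/-- `log q + 1 ≤ 9 q^{1/8}` for `q ≥ 1`. [folklore] -/
theorem log_add_one_le_rpow {q : ℕ} (hq : 1 ≤ q) : Real.log q + 1 ≤ 9 * (q : ℝ) ^ (1 / 8 : ℝ) := by
  have hq1 : (1 : ℝ) ≤ q := by exact_mod_cast hq
  have h1 := Real.log_le_rpow_div (show (0 : ℝ) ≤ q by linarith) (show (0 : ℝ) < 1 / 8 by norm_num)
  have h2 : (1 : ℝ) ≤ (q : ℝ) ^ (1 / 8 : ℝ) := Real.one_le_rpow hq1 (by norm_num)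
  linarith [show (q : ℝ) ^ (1 / 8 : ℝ) / (1 / 8) = 8 * (q : ℝ) ^ (1 / 8 : ℝ) by ring]

/-- **`log q + 1 ≪ φ(q)`**: there is `C_φ ≥ 1` with `log q + 1 ≤ C_φ φ(q)` for all `q ≥ 1`. [folklore] -/
theorem exists_log_le_mul_totient : ∃ C : ℝ, 1 ≤ C ∧ ∀ q : ℕ, q ≠ 0 → Real.log q + 1 ≤ C * Nat.totient q := by
  obtain ⟨C₀, hC₀1, hC₀⟩ := PagePNT.exists_sqrt_le_mul_totient
  refine ⟨2 * C₀ + 1, by linarith, fun q hq ↦ ?_⟩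
  have hq1 : (1 : ℝ) ≤ q := by exact_mod_cast Nat.one_le_iff_ne_zero.2 hq
  have hφ1 : (1 : ℝ) ≤ q.totient := by
    exact_mod_cast Nat.succ_le_of_lt (Nat.totient_pos.2 (Nat.pos_of_ne_zero hq))
  have h1 := hC₀ q hq
  -- `log q = 2 log √q ≤ 2(√q − 1)`
  have hs : Real.log q ≤ 2 * (Real.sqrt q - 1) := by
    have hsq : Real.log (Real.sqrt q) = Real.log q / 2 := Real.log_sqrt (by linarith)
    have := Real.log_le_sub_one_of_pos (Real.sqrt_pos.2 (by linarith : (0 : ℝ) < q))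
    linarith
  nlinarith

/-- **Small `φ(q)` forces small `q`**: if `φ(q) < B` with `B ≥ 1` then `q ≤ (81 C₀)⁴ B⁴`; we use it
in the form: `φ(q) < (log q+1)² T` (`T ≥ 1`) implies `q ≤ K T⁴` with `K = (81 C₀)⁴`. [folklore] -/
theorem exists_q_le_of_totient_lt : ∃ K : ℝ, 1 ≤ K ∧ ∀ q : ℕ, q ≠ 0 → ∀ T : ℝ, 1 ≤ T →
    (q.totient : ℝ) < (Real.log q + 1) ^ 2 * T → (q : ℝ) ≤ K * T ^ 4 := by
  obtain ⟨C₀, hC₀1, hC₀⟩ := PagePNT.exists_sqrt_le_mul_totient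
  refine ⟨(81 * C₀) ^ 4, one_le_pow₀ (by linarith), fun q hq T hT hlt ↦ ?_⟩
  have hq1 : 1 ≤ q := Nat.one_le_iff_ne_zero.2 hq
  have hq1r : (1 : ℝ) ≤ q := by exact_mod_cast hq1
  have hq0 : (0 : ℝ) < q := by linarith
  have h1 := hC₀ q hq
  have h2 := log_add_one_le_rpow hq1
  have hl0 : 0 ≤ Real.log q + 1 := by have := Real.log_natCast_nonneg q; linarith
  -- `√q ≤ C₀ φ < C₀ (log q+1)² T ≤ C₀ · 81 q^{1/4} T`
  have h3 : (Real.log q + 1) ^ 2 ≤ 81 * (q : ℝ) ^ (1 / 4 : ℝ) := by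
    have e : ((q : ℝ) ^ (1 / 8 : ℝ)) ^ 2 = (q : ℝ) ^ (1 / 4 : ℝ) := by
      rw [← Real.rpow_two, ← Real.rpow_mul hq0.le]; norm_num
    calc (Real.log q + 1) ^ 2 ≤ (9 * (q : ℝ) ^ (1 / 8 : ℝ)) ^ 2 := pow_le_pow_left₀ hl0 h2 2
      _ = 81 * (q : ℝ) ^ (1 / 4 : ℝ) := by rw [mul_pow, e]; norm_num
  have h4 : Real.sqrt q < C₀ * (81 * (q : ℝ) ^ (1 / 4 : ℝ)) * T := by
    calc Real.sqrt q ≤ C₀ * q.totient := h1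
      _ < C₀ * ((Real.log q + 1) ^ 2 * T) := by gcongr
      _ ≤ C₀ * ((81 * (q : ℝ) ^ (1 / 4 : ℝ)) * T) := by gcongr
      _ = _ := by ring
  -- `√q = q^{1/4} · q^{1/4}`
  have hq4 : 0 < (q : ℝ) ^ (1 / 4 : ℝ) := Real.rpow_pos_of_pos hq0 _
  have hsqrt : Real.sqrt q = (q : ℝ) ^ (1 / 4 : ℝ) * (q : ℝ) ^ (1 / 4 : ℝ) := by
    rw [Real.sqrt_eq_rpow, ← Real.rpow_add hq0]; norm_num
  rw [hsqrt] at h4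
  have h5 : (q : ℝ) ^ (1 / 4 : ℝ) < 81 * C₀ * T := by
    have h4' : (q : ℝ) ^ (1 / 4 : ℝ) * (q : ℝ) ^ (1 / 4 : ℝ) < (81 * C₀ * T) * (q : ℝ) ^ (1 / 4 : ℝ) := by
      calc (q : ℝ) ^ (1 / 4 : ℝ) * (q : ℝ) ^ (1 / 4 : ℝ) < C₀ * (81 * (q : ℝ) ^ (1 / 4 : ℝ)) * T := h4
        _ = (81 * C₀ * T) * (q : ℝ) ^ (1 / 4 : ℝ) := by ring
    exact lt_of_mul_lt_mul_right h4' hq4.le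
  have h6 : (q : ℝ) = ((q : ℝ) ^ (1 / 4 : ℝ)) ^ 4 := by
    rw [← Real.rpow_natCast, ← Real.rpow_mul hq0.le]; norm_num
  rw [h6]
  have h7 : ((q : ℝ) ^ (1 / 4 : ℝ)) ^ 4 ≤ (81 * C₀ * T) ^ 4 := pow_le_pow_left₀ hq4.le h5.le 4
  calc ((q : ℝ) ^ (1 / 4 : ℝ)) ^ 4 ≤ (81 * C₀ * T) ^ 4 := h7
    _ = (81 * C₀) ^ 4 * T ^ 4 := by ring

/-! ### The Siegel–Walfisz regime -/

set_option maxHeartbeats 2000000 in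
/-- **Small moduli (Siegel–Walfisz).** There is `C ≥ 0` such that for all `q`, all reduced classes
`a, b`, all `N ≥ 16` with `q ≤ (log N)^{20}/2^{20}`:
`|S₂(N) − N²/2| ≤ |R₁,a(N)| + N + φ(q)² C (N²/(log N)^{20} + N √N)`.
[cite: MontgomeryVaughan2007, Corollary 11.19 (application)] -/
theorem abs_S2_sub_le_SW : ∃ C : ℝ, 0 ≤ C ∧ ∀ (q : ℕ) [NeZero q] (a b : ZMod q), IsUnit a → IsUnit b →
    ∀ N : ℕ, 16 ≤ N → (q : ℝ) ≤ Real.log N ^ 20 / 2 ^ 20 →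
      |S2 a b N - (N : ℝ) ^ 2 / 2| ≤ |R1 a N| + N +
        (q.totient : ℝ) ^ 2 * (C * ((N : ℝ) ^ 2 / Real.log N ^ 20 + (N : ℝ) * Real.sqrt N)) := by
  obtain ⟨C₁, hC₁⟩ := Literature.NumberTheory.LFunctions.siegel_walfisz_holds 20 (by norm_num)
  set c : ℝ := Real.log 4 + 4 with hc
  have hc0 : 0 < c := by rw [hc]; have := Real.log_nonneg (show (1:ℝ) ≤ 4 by norm_num); linarith
  set C_SW : ℝ := max C₁ 0 with hCSW
  have hCSW0 : 0 ≤ C_SW := le_max_right _ _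
  refine ⟨c * (C_SW * 2 ^ 20) + c * (c + 1), by positivity, ?_⟩
  intro q _ a b ha hb N hN hq
  have hn : (16 : ℝ) ≤ N := by exact_mod_cast hN
  have hn0 : (0 : ℝ) < N := by linarith
  have hlog4 : 2 ≤ Real.log N := by
    have : Real.log 16 ≤ Real.log N := Real.log_le_log (by norm_num) hn
    have h16 : (2 : ℝ) ≤ Real.log 16 := by
      rw [← Real.log_exp 2]
      refine Real.log_le_log (Real.exp_pos 2) ?_
      have := Real.exp_one_lt_d9
      have : Real.exp 2 = Real.exp 1 * Real.exp 1 := by rw [← Real.exp_add]; norm_num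
      nlinarith [Real.exp_pos 1]
    linarith
  have hlog0 : 0 < Real.log N := by linarith
  set Φ : ℝ := (q.totient : ℝ) with hΦ
  have hΦ1 : (1 : ℝ) ≤ Φ := by rw [hΦ]; exact_mod_cast Nat.succ_le_of_lt (Nat.totient_pos.2 (NeZero.pos q))
  have hΦ0 : 0 < Φ := by linarith
  have hsq4 : 4 ≤ Real.sqrt N := by
    rw [show (4 : ℝ) = Real.sqrt 16 by rw [show (16:ℝ) = 4 ^ 2 by norm_num, Real.sqrt_sq (by norm_num)]]
    exact Real.sqrt_le_sqrt hn
  have hsqN : Real.sqrt N ≤ N := by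
    rw [Real.sqrt_le_left hn0.le]; nlinarith
  -- the error `E(k) = Ψ_b(k) − k`
  set M : ℝ := C_SW * 2 ^ 20 * N / Real.log N ^ 20 + (c + 1) * Real.sqrt N with hM
  have hM0 : 0 ≤ M := by positivity
  have hE : ∀ k : ℕ, k ≤ N → |PsiN b k - k| ≤ Φ * M := by
    intro k hk
    have hkN : (k : ℝ) ≤ N := by exact_mod_cast hk
    have hk0 : (0 : ℝ) ≤ k := Nat.cast_nonneg k
    by_cases hks : Real.sqrt N ≤ k
    · -- Siegel–Walfisz at `x = k`
      have hk2 : (2 : ℝ) ≤ k := by linarith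
      have hk0' : (0 : ℝ) < k := by linarith
      have hlogk : Real.log N / 2 ≤ Real.log k := by
        have : Real.log (Real.sqrt N) ≤ Real.log k := Real.log_le_log (by linarith) hks
        rwa [Real.log_sqrt hn0.le] at this
      have hlogk0 : 0 < Real.log k := by linarith
      have hpow : Real.log N ^ 20 / 2 ^ 20 ≤ Real.log k ^ 20 := by
        rw [div_le_iff₀ (by norm_num), show Real.log k ^ 20 * 2 ^ 20 = (Real.log k * 2) ^ 20 by ring]
        exact pow_le_pow_left₀ hlog0.le (by linarith) 20
      have hq' : (q : ℝ) ≤ Real.log k ^ (20 : ℝ) := by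
        rw [show (20 : ℝ) = ((20 : ℕ) : ℝ) by norm_num, Real.rpow_natCast]; exact hq.trans hpow
      have h := hC₁ (k : ℝ) hk2 q (NeZero.one_le) hq' hb.unit
      rw [IsUnit.unit_spec, show (20 : ℝ) = ((20 : ℕ) : ℝ) by norm_num, Real.rpow_natCast] at h
      -- `Ψ_b(k) − k = Φ (ψ(k;q,b) − k/Φ)`
      have hEq : PsiN b k - k = Φ * (Literature.NumberTheory.Sieve.ParityWave0.chebyshevPsiMod q b k - k / Φ) := by
        rw [PsiN_eq_totient_mul, ← hΦ]; field_simp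
      rw [hEq, abs_mul, abs_of_pos hΦ0]
      refine mul_le_mul_of_nonneg_left ?_ hΦ0.le
      have hC₁le : C₁ * k / Real.log k ^ 20 ≤ C_SW * 2 ^ 20 * N / Real.log N ^ 20 := by
        have h1 : C₁ * k / Real.log k ^ 20 ≤ C_SW * k / Real.log k ^ 20 := by
          refine div_le_div_of_nonneg_right ?_ (by positivity)
          exact mul_le_mul_of_nonneg_right (le_max_left _ _) hk0
        have h2 : C_SW * k / Real.log k ^ 20 ≤ C_SW * N / (Real.log N ^ 20 / 2 ^ 20) := by
          rw [div_le_div_iff₀ (by positivity) (by positivity)]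
          have : 0 ≤ C_SW * k := by positivity
          have : 0 ≤ C_SW * (N - k) := by nlinarith
          nlinarith [mul_le_mul_of_nonneg_left hpow (by positivity : 0 ≤ C_SW * k),
            mul_nonneg this (by positivity : (0:ℝ) ≤ Real.log N ^ 20 / 2 ^ 20)]
        have h3 : C_SW * N / (Real.log N ^ 20 / 2 ^ 20) = C_SW * 2 ^ 20 * N / Real.log N ^ 20 := by
          field_simp
        linarith
      have hunit : Literature.NumberTheory.Sieve.ParityWave0.chebyshevPsiMod q (↑hb.unit) (k : ℝ) =
          Literature.NumberTheory.Sieve.ParityWave0.chebyshevPsiMod q b k := by rw [IsUnit.unit_spec]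
      calc |Literature.NumberTheory.Sieve.ParityWave0.chebyshevPsiMod q b k - k / Φ|
          ≤ C₁ * k / Real.log k ^ 20 := by rw [hΦ]; simpa [hunit] using h
        _ ≤ C_SW * 2 ^ 20 * N / Real.log N ^ 20 := hC₁le
        _ ≤ M := by
            rw [hM]
            have h0 : 0 ≤ (c + 1) * Real.sqrt N := by positivity
            linarith
    · -- small `k`: trivial
      rw [not_le] at hks
      have h1 := PsiN_le_linear b k
      have h0 := PsiN_nonneg b k
      rw [← hΦ, ← hc] at h1
      have hbd : |PsiN b k - k| ≤ Φ * (c * k) + k := by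
        rw [abs_le]; constructor <;> nlinarith
      calc |PsiN b k - k| ≤ Φ * (c * k) + k := hbd
        _ ≤ Φ * (c * Real.sqrt N) + Φ * Real.sqrt N := by
            have : (k : ℝ) ≤ Φ * Real.sqrt N := by nlinarith
            nlinarith [mul_le_mul_of_nonneg_left hks.le (by positivity : 0 ≤ Φ * c)]
        _ = Φ * ((c + 1) * Real.sqrt N) := by ring
        _ ≤ Φ * M := by
            refine mul_le_mul_of_nonneg_left ?_ hΦ0.le
            rw [hM]
            have h0 : 0 ≤ C_SW * 2 ^ 20 * N / Real.log N ^ 20 := by positivity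
            linarith
  -- the decomposition `S₂(N) = ψ₁(N) + ∑ Λ_a(l) E(N − l)`
  have hS : S2 a b N = ClassicalPsiData.rieszMean (Lam a) N + ∑ l ∈ range (N + 1), Lam a l * (PsiN b (N - l) - ((N - l : ℕ) : ℝ)) := by
    rw [S2_eq_sum_PsiN, rieszMean_natCast, ← sum_add_distrib]
    refine sum_congr rfl fun l hl ↦ ?_
    rw [Finset.mem_range] at hl
    rw [Nat.cast_sub (by omega)]
    ring
  have hR : ClassicalPsiData.rieszMean (Lam a) N = R1 a N + ((N : ℝ) - 1) ^ 2 / 2 := by rw [R1]; ring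
  have hsum : |∑ l ∈ range (N + 1), Lam a l * (PsiN b (N - l) - ((N - l : ℕ) : ℝ))| ≤ Φ * M * (Φ * (c * N)) := by
    refine (Finset.abs_sum_le_sum_abs _ _).trans ?_
    have hterm : ∀ l ∈ range (N + 1), |Lam a l * (PsiN b (N - l) - ((N - l : ℕ) : ℝ))| ≤ Lam a l * (Φ * M) := by
      intro l _
      rw [abs_mul, abs_of_nonneg (Lam_nonneg a l)]
      exact mul_le_mul_of_nonneg_left (hE (N - l) (Nat.sub_le N l)) (Lam_nonneg a l)
    refine (sum_le_sum hterm).trans ?_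
    rw [← sum_mul]
    have hPsi : ∑ l ∈ range (N + 1), Lam a l = PsiN a N := rfl
    rw [hPsi]
    have h1 := PsiN_le_linear a N
    rw [← hΦ, ← hc] at h1
    calc PsiN a N * (Φ * M) ≤ (Φ * (c * N)) * (Φ * M) := mul_le_mul_of_nonneg_right h1 (by positivity)
      _ = Φ * M * (Φ * (c * N)) := by ring
  have hlin : |((N : ℝ) - 1) ^ 2 / 2 - (N : ℝ) ^ 2 / 2| ≤ (N : ℝ) := by
    rw [abs_le]; constructor <;> nlinarith
  calc |S2 a b N - (N : ℝ) ^ 2 / 2|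
      = |R1 a N + (((N : ℝ) - 1) ^ 2 / 2 - (N : ℝ) ^ 2 / 2) +
          ∑ l ∈ range (N + 1), Lam a l * (PsiN b (N - l) - ((N - l : ℕ) : ℝ))| := by rw [hS, hR]; ring_nf
    _ ≤ |R1 a N| + |((N : ℝ) - 1) ^ 2 / 2 - (N : ℝ) ^ 2 / 2| +
          |∑ l ∈ range (N + 1), Lam a l * (PsiN b (N - l) - ((N - l : ℕ) : ℝ))| := by
        have h1 := abs_add_le (R1 a N + (((N : ℝ) - 1) ^ 2 / 2 - (N : ℝ) ^ 2 / 2))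
          (∑ l ∈ range (N + 1), Lam a l * (PsiN b (N - l) - ((N - l : ℕ) : ℝ)))
        have h2 := abs_add_le (R1 a N) (((N : ℝ) - 1) ^ 2 / 2 - (N : ℝ) ^ 2 / 2)
        linarith
    _ ≤ |R1 a N| + N + Φ * M * (Φ * (c * N)) := by linarith [hsum, hlin]
    _ = |R1 a N| + N + Φ ^ 2 * (c * (C_SW * 2 ^ 20) * ((N : ℝ) ^ 2 / Real.log N ^ 20) +
          c * (c + 1) * ((N : ℝ) * Real.sqrt N)) := by rw [hM]; field_simp
    _ ≤ |R1 a N| + N + Φ ^ 2 * ((c * (C_SW * 2 ^ 20) + c * (c + 1)) *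
          ((N : ℝ) ^ 2 / Real.log N ^ 20 + (N : ℝ) * Real.sqrt N)) := by
        have h1 : 0 ≤ (N : ℝ) ^ 2 / Real.log N ^ 20 := by positivity
        have h2 : 0 ≤ (N : ℝ) * Real.sqrt N := by positivity
        have h3 : 0 ≤ c * (C_SW * 2 ^ 20) := by positivity
        have h4 : 0 ≤ c * (c + 1) := by positivity
        have : c * (C_SW * 2 ^ 20) * ((N : ℝ) ^ 2 / Real.log N ^ 20) + c * (c + 1) * ((N : ℝ) * Real.sqrt N) ≤
            (c * (C_SW * 2 ^ 20) + c * (c + 1)) * ((N : ℝ) ^ 2 / Real.log N ^ 20 + (N : ℝ) * Real.sqrt N) := by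
          nlinarith [mul_nonneg h3 h2, mul_nonneg h4 h1]
        nlinarith [sq_nonneg Φ]

/-! ### Thresholds in `N` -/

/-- `log n ≤ 32 n^{1/32}` (`n ≥ 0`). [folklore] -/
theorem log_le_rpow_32 {n : ℝ} (hn : 0 ≤ n) : Real.log n ≤ 32 * n ^ (1 / 32 : ℝ) := by
  have h := Real.log_le_rpow_div hn (show (0 : ℝ) < 1 / 32 by norm_num)
  linarith [show n ^ (1 / 32 : ℝ) / (1 / 32) = 32 * n ^ (1 / 32 : ℝ) by ring]

set_option maxHeartbeats 2000000 in
/-- The numerical thresholds: for `K ≥ 1`, `C_B ≥ 0` and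
`n ≥ exp(2³²K + 2⁹C_B + 4) + (2⁴⁹(C_B+1))⁴ + 4096`, one has `n ≥ 4096`, `log n ≥ 4`,
`K (log n+1)^{12} ≤ (log n)^{20}/2^{20}`, `C_B n²/(log n)^{20} ≤ n²/(2(log n+1)⁸)`,
`C_B n√n ≤ n²/(2(log n+1)⁸)` and `(log n+1)² ≤ n^{3/2}`. [folklore] -/
theorem thresholds {K CB n : ℝ} (hK : 1 ≤ K) (hCB : 0 ≤ CB)
    (hn : Real.exp (2 ^ 32 * K + 2 ^ 9 * CB + 4) + (2 ^ 49 * (CB + 1)) ^ 4 + 4096 ≤ n) :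
    4096 ≤ n ∧ 4 ≤ Real.log n ∧
    K * (Real.log n + 1) ^ 12 ≤ Real.log n ^ 20 / 2 ^ 20 ∧
    CB * (n ^ 2 / Real.log n ^ 20) ≤ n ^ 2 / (2 * (Real.log n + 1) ^ 8) ∧
    CB * (n * Real.sqrt n) ≤ n ^ 2 / (2 * (Real.log n + 1) ^ 8) ∧
    (Real.log n + 1) ^ 2 ≤ n ^ (3 / 2 : ℝ) := by
  have he0 : 0 < Real.exp (2 ^ 32 * K + 2 ^ 9 * CB + 4) := Real.exp_pos _
  have hp0 : 0 ≤ (2 ^ 49 * (CB + 1)) ^ 4 := by positivity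
  have hn4096 : (4096 : ℝ) ≤ n := by linarith
  have hn0 : 0 < n := by linarith
  have hn1 : 1 ≤ n := by linarith
  set L : ℝ := Real.log n with hL
  have hLge : 2 ^ 32 * K + 2 ^ 9 * CB + 4 ≤ L := by
    rw [hL, ← Real.log_exp (2 ^ 32 * K + 2 ^ 9 * CB + 4)]
    exact Real.log_le_log he0 (by linarith)
  have hL4 : 4 ≤ L := by nlinarith
  have hL1 : 1 ≤ L := by linarith
  have hL0 : 0 < L := by linarith
  have hLK : 2 ^ 32 * K ≤ L := by nlinarith
  have hLC : 2 ^ 9 * CB ≤ L := by nlinarith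
  have hL1' : L + 1 ≤ 2 * L := by linarith
  -- powers of `L`
  have hL8 : L ≤ L ^ 8 := le_self_pow₀ hL1 (by norm_num)
  have hL12 : L ≤ L ^ 12 := le_self_pow₀ hL1 (by norm_num)
  have hpow12 : (L + 1) ^ 12 ≤ 2 ^ 12 * L ^ 12 := by
    calc (L + 1) ^ 12 ≤ (2 * L) ^ 12 := pow_le_pow_left₀ (by linarith) hL1' 12
      _ = 2 ^ 12 * L ^ 12 := by ring
  have hpow8 : (L + 1) ^ 8 ≤ 2 ^ 8 * L ^ 8 := by
    calc (L + 1) ^ 8 ≤ (2 * L) ^ 8 := pow_le_pow_left₀ (by linarith) hL1' 8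
      _ = 2 ^ 8 * L ^ 8 := by ring
  -- `L ≤ 32 n^{1/32}`, hence `(L+1)^8 ≤ 2^48 n^{1/4}` and `(L+1)² ≤ 4096 n^{1/16}`
  have hLr := log_le_rpow_32 hn0.le
  rw [← hL] at hLr
  have hr0 : 0 ≤ n ^ (1 / 32 : ℝ) := Real.rpow_nonneg hn0.le _
  have hL1pow8 : (L + 1) ^ 8 ≤ 2 ^ 48 * n ^ (1 / 4 : ℝ) := by
    have e : (n ^ (1 / 32 : ℝ)) ^ 8 = n ^ (1 / 4 : ℝ) := by
      rw [← Real.rpow_natCast, ← Real.rpow_mul hn0.le]; norm_num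
    calc (L + 1) ^ 8 ≤ (2 * L) ^ 8 := pow_le_pow_left₀ (by linarith) hL1' 8
      _ ≤ (2 * (32 * n ^ (1 / 32 : ℝ))) ^ 8 := pow_le_pow_left₀ (by linarith) (by linarith) 8
      _ = 2 ^ 48 * (n ^ (1 / 32 : ℝ)) ^ 8 := by ring
      _ = 2 ^ 48 * n ^ (1 / 4 : ℝ) := by rw [e]
  have hL1pow2 : (L + 1) ^ 2 ≤ 4096 * n ^ (1 / 16 : ℝ) := by
    have e : (n ^ (1 / 32 : ℝ)) ^ 2 = n ^ (1 / 16 : ℝ) := by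
      rw [← Real.rpow_natCast, ← Real.rpow_mul hn0.le]; norm_num
    calc (L + 1) ^ 2 ≤ (2 * L) ^ 2 := pow_le_pow_left₀ (by linarith) hL1' 2
      _ ≤ (2 * (32 * n ^ (1 / 32 : ℝ))) ^ 2 := pow_le_pow_left₀ (by linarith) (by linarith) 2
      _ = 4096 * (n ^ (1 / 32 : ℝ)) ^ 2 := by ring
      _ = 4096 * n ^ (1 / 16 : ℝ) := by rw [e]
  refine ⟨hn4096, hL4, ?_, ?_, ?_, ?_⟩
  · -- (ii)
    have h2 : 2 ^ 32 * K * L ^ 12 ≤ L ^ 20 := by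
      have : L ^ 20 = L ^ 8 * L ^ 12 := by ring
      rw [this]
      exact mul_le_mul_of_nonneg_right (hLK.trans hL8) (by positivity)
    rw [le_div_iff₀ (by norm_num)]
    nlinarith [mul_le_mul_of_nonneg_left hpow12 (by linarith : 0 ≤ K)]
  · -- (iii)
    have hL1p : 0 < (L + 1) ^ 8 := by positivity
    rw [mul_div_assoc', div_le_div_iff₀ (by positivity) (by positivity)]
    have h3 : 2 ^ 9 * CB * L ^ 8 ≤ L ^ 20 := by
      have : L ^ 20 = L ^ 12 * L ^ 8 := by ring
      rw [this]
      exact mul_le_mul_of_nonneg_right (hLC.trans hL12) (by positivity)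
    have h4 : CB * (2 * (L + 1) ^ 8) ≤ L ^ 20 := by nlinarith [mul_le_mul_of_nonneg_left hpow8 hCB]
    have hn2 : 0 ≤ n ^ 2 := by positivity
    nlinarith [mul_le_mul_of_nonneg_left h4 hn2]
  · -- (iv)
    have hq0 : 0 < n ^ (1 / 4 : ℝ) := Real.rpow_pos_of_pos hn0 _
    have hquarter : 2 ^ 49 * (CB + 1) ≤ n ^ (1 / 4 : ℝ) := by
      have h1 : ((2 ^ 49 * (CB + 1)) ^ 4) ^ (1 / 4 : ℝ) ≤ n ^ (1 / 4 : ℝ) :=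
        Real.rpow_le_rpow hp0 (by linarith) (by norm_num)
      have e : ((2 ^ 49 * (CB + 1)) ^ 4) ^ (1 / 4 : ℝ) = 2 ^ 49 * (CB + 1) := by
        rw [← Real.rpow_natCast, ← Real.rpow_mul (by positivity)]; norm_num
      rwa [e] at h1
    have hsqrt : Real.sqrt n = n ^ (1 / 4 : ℝ) * n ^ (1 / 4 : ℝ) := by
      rw [Real.sqrt_eq_rpow, ← Real.rpow_add hn0]; norm_num
    have hn34 : n = n ^ (1 / 4 : ℝ) * n ^ (1 / 4 : ℝ) * n ^ (1 / 4 : ℝ) * n ^ (1 / 4 : ℝ) := by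
      rw [← Real.rpow_add hn0, ← Real.rpow_add hn0, ← Real.rpow_add hn0]; norm_num
    -- `2 C_B (L+1)^8 √n ≤ n`
    have hkey : CB * (2 * (L + 1) ^ 8) * Real.sqrt n ≤ n := by
      have h1 : CB * (2 * (L + 1) ^ 8) ≤ 2 ^ 49 * CB * n ^ (1 / 4 : ℝ) := by nlinarith [mul_le_mul_of_nonneg_left hL1pow8 hCB]
      have h2 : 2 ^ 49 * CB ≤ n ^ (1 / 4 : ℝ) := by nlinarith
      calc CB * (2 * (L + 1) ^ 8) * Real.sqrt n ≤ (2 ^ 49 * CB * n ^ (1 / 4 : ℝ)) * Real.sqrt n :=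
            mul_le_mul_of_nonneg_right h1 (Real.sqrt_nonneg n)
        _ = 2 ^ 49 * CB * (n ^ (1 / 4 : ℝ) * n ^ (1 / 4 : ℝ) * n ^ (1 / 4 : ℝ)) := by rw [hsqrt]; ring
        _ ≤ n ^ (1 / 4 : ℝ) * (n ^ (1 / 4 : ℝ) * n ^ (1 / 4 : ℝ) * n ^ (1 / 4 : ℝ)) :=
            mul_le_mul_of_nonneg_right h2 (by positivity)
        _ = n ^ (1 / 4 : ℝ) * n ^ (1 / 4 : ℝ) * n ^ (1 / 4 : ℝ) * n ^ (1 / 4 : ℝ) := by ring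
        _ = n := hn34.symm
    have hL1p : 0 < (L + 1) ^ 8 := by positivity
    rw [le_div_iff₀ (by positivity)]
    nlinarith [mul_le_mul_of_nonneg_left hkey hn0.le]
  · -- (v)
    have h1 : (4096 : ℝ) * n ^ (1 / 16 : ℝ) ≤ n ^ (3 / 2 : ℝ) := by
      have e : n ^ (3 / 2 : ℝ) = n ^ (23 / 16 : ℝ) * n ^ (1 / 16 : ℝ) := by
        rw [← Real.rpow_add hn0]; norm_num
      rw [e]
      refine mul_le_mul_of_nonneg_right ?_ (Real.rpow_nonneg hn0.le _)
      calc (4096 : ℝ) ≤ n := hn4096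
        _ = n ^ (1 : ℝ) := (Real.rpow_one n).symm
        _ ≤ n ^ (23 / 16 : ℝ) := Real.rpow_le_rpow_of_exponent_le hn1 (by norm_num)
    exact hL1pow2.trans h1

/-! ### The main theorem -/

set_option maxHeartbeats 4000000 in
/-- The estimate for `S₂ = φ² S`: there is an absolute `C` with
`|S₂(x) − x²/2| ≤ C φ(q)² x^{1+σ₁}` for all `q`, reduced `a, b`, `σ₁ ≥ 1/2` with
`ZerosRealPartLE q σ₁`, and `x ≥ 2`. [cite: BhowmikHalupczokMatsumotoSuzuki2019, Theorem 1 (1)] -/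
theorem abs_S2_sub_le_final : ∃ C : ℝ, 0 < C ∧ ∀ (q : ℕ) [NeZero q] (a b : ZMod q), IsUnit a → IsUnit b →
    ∀ σ₁ : ℝ, 1 / 2 ≤ σ₁ → ResidueRiesz.ZerosRealPartLE q σ₁ → ∀ x : ℕ, 2 ≤ x →
      |S2 a b x - (x : ℝ) ^ 2 / 2| ≤ C * (q.totient : ℝ) ^ 2 * (x : ℝ) ^ (1 + σ₁) := by
  obtain ⟨CG, hCG0, hCG⟩ := abs_S2_sub_le
  obtain ⟨CD, hCD0, hCD⟩ := abs_rieszMean_sub_le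
  obtain ⟨Cφ, hCφ1, hCφ⟩ := exists_log_le_mul_totient
  obtain ⟨K, hK1, hK⟩ := exists_q_le_of_totient_lt
  obtain ⟨CB, hCB0, hCB⟩ := abs_S2_sub_le_SW
  set c : ℝ := Real.log 4 + 4 with hc
  have hc0 : 0 < c := by rw [hc]; have := Real.log_nonneg (show (1:ℝ) ≤ 4 by norm_num); linarith
  set Nstar : ℝ := Real.exp (2 ^ 32 * K + 2 ^ 9 * CB + 4) + (2 ^ 49 * (CB + 1)) ^ 4 + 4096 with hNstar
  have hNstar1 : 1 ≤ Nstar := by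
    have := Real.exp_pos (2 ^ 32 * K + 2 ^ 9 * CB + 4)
    have : 0 ≤ (2 ^ 49 * (CB + 1)) ^ 4 := by positivity
    rw [hNstar]; linarith
  set Ctriv : ℝ := (c ^ 2 + 1) * (Real.exp 4 + Nstar) with hCtriv
  set CA : ℝ := CG * (Cφ + 1) with hCA
  set CB2 : ℝ := Real.exp 2 * CD * Cφ + 1 + (Real.log K + 13) ^ 4 with hCB2
  have hlogK : 0 ≤ Real.log K := Real.log_nonneg hK1
  have hCtriv0 : 0 ≤ Ctriv := by positivity
  have hCA0 : 0 ≤ CA := by positivity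
  have hCB20 : 0 ≤ CB2 := by positivity
  refine ⟨Ctriv + CA + 6 + CB2, by positivity, ?_⟩
  intro q _ a b ha hb σ₁ hσ₁ hZ x hx
  set Φ : ℝ := (q.totient : ℝ) with hΦ
  have hΦ1 : (1 : ℝ) ≤ Φ := by rw [hΦ]; exact_mod_cast Nat.succ_le_of_lt (Nat.totient_pos.2 (NeZero.pos q))
  have hΦ2 : 1 ≤ Φ ^ 2 := by nlinarith
  set n : ℝ := (x : ℝ) with hn
  have hn2 : (2 : ℝ) ≤ n := by rw [hn]; exact_mod_cast hx
  have hn0 : 0 < n := by linarith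
  have hn1 : 1 ≤ n := by linarith
  set P : ℝ := n ^ (1 + σ₁) with hP
  have hP0 : 0 < P := Real.rpow_pos_of_pos hn0 _
  have hσ0 : 0 ≤ σ₁ := by linarith
  -- the four non-negative pieces of the constant
  have hsplit : ∀ T : ℝ, 0 ≤ T → (T ≤ Ctriv ∨ T ≤ CA ∨ T ≤ 6 ∨ T ≤ CB2) →
      T * Φ ^ 2 * P ≤ (Ctriv + CA + 6 + CB2) * Φ ^ 2 * P := by
    intro T _ hT
    refine mul_le_mul_of_nonneg_right (mul_le_mul_of_nonneg_right ?_ (by positivity)) hP0.le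
    rcases hT with h | h | h | h <;> linarith
  -- the log-free trivial bound
  have htriv : |S2 a b x - n ^ 2 / 2| ≤ (c ^ 2 + 1) * Φ ^ 2 * n ^ 2 := by
    have h := abs_S2_sub_le_trivial a b x
    rw [← hΦ, ← hc, ← hn] at h
    refine h.trans ?_
    have : 0 ≤ n ^ 2 := by positivity
    nlinarith
  -- `n² = P · n^{1−σ₁}`
  have hn2P : n ^ 2 = P * n ^ (1 - σ₁) := by
    rw [hP, ← Real.rpow_add hn0, ← Real.rpow_two]; ring_nf
  by_cases hσ1 : 1 ≤ σ₁
  · -- T3: `σ₁ ≥ 1`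
    have hle : n ^ 2 ≤ P := by
      rw [hP, ← Real.rpow_two]; exact Real.rpow_le_rpow_of_exponent_le hn1 (by linarith)
    calc |S2 a b x - n ^ 2 / 2| ≤ (c ^ 2 + 1) * Φ ^ 2 * n ^ 2 := htriv
      _ ≤ (c ^ 2 + 1) * Φ ^ 2 * P := by gcongr
      _ ≤ Ctriv * Φ ^ 2 * P := by
          refine mul_le_mul_of_nonneg_right (mul_le_mul_of_nonneg_right ?_ (by positivity)) hP0.le
          rw [hCtriv]
          have : 1 ≤ Real.exp 4 + Nstar := by linarith [Real.exp_pos (4:ℝ)]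
          nlinarith
      _ ≤ _ := hsplit Ctriv hCtriv0 (Or.inl le_rfl)
  rw [not_le] at hσ1
  by_cases hsmall : n < Nstar
  · -- T1: `x < N_*`
    have hle : n ^ 2 ≤ P * Nstar := by
      rw [hn2P]
      refine mul_le_mul_of_nonneg_left ?_ hP0.le
      calc n ^ (1 - σ₁) ≤ n ^ (1 : ℝ) := Real.rpow_le_rpow_of_exponent_le hn1 (by linarith)
        _ = n := Real.rpow_one n
        _ ≤ Nstar := hsmall.le
    calc |S2 a b x - n ^ 2 / 2| ≤ (c ^ 2 + 1) * Φ ^ 2 * n ^ 2 := htriv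
      _ ≤ (c ^ 2 + 1) * Φ ^ 2 * (P * Nstar) := by gcongr
      _ ≤ Ctriv * Φ ^ 2 * P := by
          rw [hCtriv]
          have : 0 ≤ (c ^ 2 + 1) * Φ ^ 2 * P * Real.exp 4 := by positivity
          nlinarith
      _ ≤ _ := hsplit Ctriv hCtriv0 (Or.inl le_rfl)
  rw [not_lt] at hsmall
  -- from now on `n ≥ N_*`
  obtain ⟨hn4096, hL4, hKL, hCB1, hCB2', hLN2⟩ := thresholds hK1 hCB0 hsmall
  have hx16 : 16 ≤ x := by
    have : (16 : ℝ) ≤ x := by rw [← hn]; linarith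
    exact_mod_cast this
  have hlog0 : 0 < Real.log n := by linarith
  by_cases hT2 : 1 < σ₁ + 4 / Real.log n
  · -- T2: `x^{1−σ₁} < e⁴`
    have hle : n ^ (1 - σ₁) ≤ Real.exp 4 := by
      calc n ^ (1 - σ₁) ≤ n ^ (2 * (2 / Real.log n)) := Real.rpow_le_rpow_of_exponent_le hn1 (by
            have : 4 / Real.log n = 2 * (2 / Real.log n) := by ring
            linarith)
        _ = Real.exp 4 := by rw [rpow_mul_two_div_log (by linarith)]; norm_num
    calc |S2 a b x - n ^ 2 / 2| ≤ (c ^ 2 + 1) * Φ ^ 2 * n ^ 2 := htriv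
      _ = (c ^ 2 + 1) * Φ ^ 2 * (P * n ^ (1 - σ₁)) := by rw [hn2P]
      _ ≤ (c ^ 2 + 1) * Φ ^ 2 * (P * Real.exp 4) := by gcongr
      _ ≤ Ctriv * Φ ^ 2 * P := by
          rw [hCtriv]
          have : 0 ≤ (c ^ 2 + 1) * Φ ^ 2 * P * Nstar := by positivity
          nlinarith
      _ ≤ _ := hsplit Ctriv hCtriv0 (Or.inl le_rfl)
  rw [not_lt] at hT2
  -- MAIN: `σ₁ + 4/log n ≤ 1`, `1/2 ≤ σ₁ < 1`, `x ≥ 16`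
  set D : ℝ := n ^ ((1 - σ₁) / 2) with hD
  have hD0 : 0 < D := Real.rpow_pos_of_pos hn0 _
  have hD2 : D ^ 2 = n ^ (1 - σ₁) := by
    rw [hD, ← Real.rpow_natCast, ← Real.rpow_mul hn0.le]; congr 1; push_cast; ring
  have hn2D : n ^ 2 = P * D ^ 2 := by rw [hD2, hn2P]
  have hSv : n ^ (-((1 - σ₁) / 2)) = 1 / D := by rw [Real.rpow_neg hn0.le, ← hD, one_div]
  set Lq1 : ℝ := Real.log q + 1 with hLq1
  have hLq1pos : 1 ≤ Lq1 := by have := Real.log_natCast_nonneg q; rw [hLq1]; linarith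
  have hLq1Φ : Lq1 ≤ Cφ * Φ := by rw [hLq1, hΦ]; exact hCφ q (NeZero.ne q)
  set LN : ℝ := Real.log n + 1 with hLN
  have hLN1 : 1 ≤ LN := by rw [hLN]; linarith
  have hnP : n ≤ P := by
    calc n = n ^ (1 : ℝ) := (Real.rpow_one n).symm
      _ ≤ P := Real.rpow_le_rpow_of_exponent_le hn1 (by linarith)
  by_cases hA : Lq1 ^ 2 * LN ^ 2 ≤ D
  · -- Case A: the bilinear bound
    have h := hCG q a b ha hb σ₁ hσ₁ hZ x hx16 hT2
    rw [← hn, ← hΦ, ← hLq1, ← hLN, hSv] at h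
    have hfrac : Φ * Lq1 ^ 2 * LN ^ 2 * (1 / D) ≤ Φ := by
      rw [mul_one_div, div_le_iff₀ hD0]
      calc Φ * Lq1 ^ 2 * LN ^ 2 = Φ * (Lq1 ^ 2 * LN ^ 2) := by ring
        _ ≤ Φ * D := mul_le_mul_of_nonneg_left hA (by linarith)
    calc |S2 a b x - n ^ 2 / 2| ≤ CG * Φ * P * (Lq1 + Φ * Lq1 ^ 2 * LN ^ 2 * (1 / D)) := h
      _ ≤ CG * Φ * P * (Cφ * Φ + Φ) := by
          refine mul_le_mul_of_nonneg_left (add_le_add hLq1Φ hfrac) (by positivity)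
      _ = CA * Φ ^ 2 * P := by rw [hCA]; ring
      _ ≤ _ := hsplit CA hCA0 (Or.inr (Or.inl le_rfl))
  rw [not_le] at hA
  by_cases hB1 : D * LN ≤ Φ
  · -- Case B1: trivial bound with the modulus
    have h := abs_S2_sub_le_trivial_log a b (show 1 ≤ x by omega)
    rw [← hn, ← hΦ, ← hLN] at h
    -- `n² LN² ≤ Φ² P` and `Φ² LN² ≤ Φ² P`
    have h1 : n ^ 2 * LN ^ 2 ≤ Φ ^ 2 * P := by
      rw [hn2D]
      have : D ^ 2 * LN ^ 2 ≤ Φ ^ 2 := by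
        calc D ^ 2 * LN ^ 2 = (D * LN) ^ 2 := by ring
          _ ≤ Φ ^ 2 := pow_le_pow_left₀ (by positivity) hB1 2
      nlinarith [hP0]
    have h2 : LN ^ 2 ≤ P := by
      calc LN ^ 2 ≤ n ^ (3 / 2 : ℝ) := hLN2
        _ ≤ P := Real.rpow_le_rpow_of_exponent_le hn1 (by linarith)
    calc |S2 a b x - n ^ 2 / 2| ≤ 3 * (n ^ 2 + Φ ^ 2) * LN ^ 2 := h
      _ = 3 * (n ^ 2 * LN ^ 2) + 3 * Φ ^ 2 * LN ^ 2 := by ring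
      _ ≤ 3 * (Φ ^ 2 * P) + 3 * Φ ^ 2 * P := by
          have := mul_le_mul_of_nonneg_left h2 (by positivity : (0:ℝ) ≤ 3 * Φ ^ 2)
          linarith
      _ = 6 * Φ ^ 2 * P := by ring
      _ ≤ _ := hsplit 6 (by norm_num) (Or.inr (Or.inr (Or.inl le_rfl)))
  rw [not_le] at hB1
  -- Case B2: Siegel–Walfisz
  have hΦlt : Φ < Lq1 ^ 2 * LN ^ 3 := by
    calc Φ < D * LN := hB1
      _ ≤ (Lq1 ^ 2 * LN ^ 2) * LN := mul_le_mul_of_nonneg_right hA.le (by linarith)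
      _ = Lq1 ^ 2 * LN ^ 3 := by ring
  have hqK : (q : ℝ) ≤ K * (LN ^ 3) ^ 4 := by
    refine hK q (NeZero.ne q) (LN ^ 3) (one_le_pow₀ hLN1) ?_
    rw [← hLq1]; exact hΦlt
  have hqK' : (q : ℝ) ≤ K * LN ^ 12 := by rw [show LN ^ 12 = (LN ^ 3) ^ 4 by ring]; exact hqK
  have hqSW : (q : ℝ) ≤ Real.log n ^ 20 / 2 ^ 20 := hqK'.trans hKL
  have hSWb := hCB q a b ha hb x hx16 (by rw [← hn]; exact hqSW)
  rw [← hn, ← hΦ] at hSWb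
  -- `n²/LN⁸ ≤ (log K + 13)⁴ P`
  have hq1 : (1 : ℝ) ≤ q := by exact_mod_cast NeZero.one_le
  have hLq1LN : Lq1 ≤ (Real.log K + 13) * LN := by
    have h1 : Real.log q ≤ Real.log K + 12 * Real.log LN := by
      have hKL0 : 0 < K * LN ^ 12 := by positivity
      calc Real.log q ≤ Real.log (K * LN ^ 12) := Real.log_le_log (by linarith) hqK'
        _ = Real.log K + 12 * Real.log LN := by rw [Real.log_mul (by linarith) (by positivity), Real.log_pow]; push_cast; ring
    have h2 : Real.log LN ≤ LN := (Real.log_le_sub_one_of_pos (by linarith)).trans (by linarith)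
    rw [hLq1]
    nlinarith [mul_le_mul_of_nonneg_left hLN1 hlogK]
  have hD2le : D ^ 2 ≤ (Real.log K + 13) ^ 4 * LN ^ 8 := by
    have h1 : D ≤ Lq1 ^ 2 * LN ^ 2 := hA.le
    have h2 : Lq1 ^ 2 ≤ (Real.log K + 13) ^ 2 * LN ^ 2 := by
      calc Lq1 ^ 2 ≤ ((Real.log K + 13) * LN) ^ 2 := pow_le_pow_left₀ (by linarith) hLq1LN 2
        _ = _ := by ring
    calc D ^ 2 ≤ (Lq1 ^ 2 * LN ^ 2) ^ 2 := pow_le_pow_left₀ hD0.le h1 2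
      _ ≤ ((Real.log K + 13) ^ 2 * LN ^ 2 * LN ^ 2) ^ 2 := by
          refine pow_le_pow_left₀ (by positivity) ?_ 2
          exact mul_le_mul_of_nonneg_right h2 (by positivity)
      _ = (Real.log K + 13) ^ 4 * LN ^ 8 := by ring
  have hLN8 : 0 < LN ^ 8 := by positivity
  have hmainSW : n ^ 2 / LN ^ 8 ≤ (Real.log K + 13) ^ 4 * P := by
    rw [div_le_iff₀ hLN8, hn2D]
    nlinarith [mul_le_mul_of_nonneg_left hD2le hP0.le]
  -- `R₁` bound
  have hε0 : 0 < 2 / Real.log n := by positivity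
  have hσε : σ₁ + 2 / Real.log n < 1 := by
    have : 2 / Real.log n < 4 / Real.log n := by rw [div_lt_div_iff_of_pos_right hlog0]; norm_num
    linarith
  have hR1 : |R1 a n| ≤ Real.exp 2 * CD * Cφ * Φ ^ 2 * P := by
    have h := hCD q a ha σ₁ hσ₁ hZ (2 / Real.log n) hε0 hσε n hn1 (by
      rw [div_mul_eq_mul_div, le_div_iff₀ hlog0]; linarith)
    rw [← hΦ, ← hLq1] at h
    have hpow : n ^ (1 + σ₁ + 2 / Real.log n) = P * Real.exp 2 := by
      rw [Real.rpow_add hn0, ← hP, rpow_two_div_log (by linarith)]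
    rw [R1]
    calc |ClassicalPsiData.rieszMean (Lam a) n - (n - 1) ^ 2 / 2| ≤ CD * Φ * Lq1 * n ^ (1 + σ₁ + 2 / Real.log n) := h
      _ = CD * Φ * Lq1 * (P * Real.exp 2) := by rw [hpow]
      _ ≤ CD * Φ * (Cφ * Φ) * (P * Real.exp 2) := by
          refine mul_le_mul_of_nonneg_right (mul_le_mul_of_nonneg_left hLq1Φ (by positivity)) (by positivity)
      _ = Real.exp 2 * CD * Cφ * Φ ^ 2 * P := by ring
  calc |S2 a b x - n ^ 2 / 2|
      ≤ |R1 a n| + n + Φ ^ 2 * (CB * (n ^ 2 / Real.log n ^ 20 + n * Real.sqrt n)) := hSWb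
    _ = |R1 a n| + n + Φ ^ 2 * (CB * (n ^ 2 / Real.log n ^ 20) + CB * (n * Real.sqrt n)) := by ring
    _ ≤ Real.exp 2 * CD * Cφ * Φ ^ 2 * P + Φ ^ 2 * P + Φ ^ 2 * (n ^ 2 / LN ^ 8) := by
        have h1 : n ≤ Φ ^ 2 * P := by nlinarith
        have h2 : CB * (n ^ 2 / Real.log n ^ 20) + CB * (n * Real.sqrt n) ≤ n ^ 2 / LN ^ 8 := by
          have := add_le_add hCB1 hCB2'
          have e : n ^ 2 / (2 * LN ^ 8) + n ^ 2 / (2 * LN ^ 8) = n ^ 2 / LN ^ 8 := by field_simp; ring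
          linarith
        nlinarith [mul_le_mul_of_nonneg_left h2 (by positivity : (0:ℝ) ≤ Φ ^ 2)]
    _ ≤ Real.exp 2 * CD * Cφ * Φ ^ 2 * P + Φ ^ 2 * P + Φ ^ 2 * ((Real.log K + 13) ^ 4 * P) := by
        have := mul_le_mul_of_nonneg_left hmainSW (by positivity : (0:ℝ) ≤ Φ ^ 2)
        linarith
    _ = CB2 * Φ ^ 2 * P := by rw [hCB2]; ring
    _ ≤ _ := hsplit CB2 hCB20 (Or.inr (Or.inr (Or.inr le_rfl)))

/-- **Bhowmik–Halupczok–Matsumoto–Suzuki 2019, Theorem 1 (1), PROVED**: for `(a, q) = (b, q) = 1`,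
`σ₁ ≥ 1/2` bounding the real parts of the non-trivial zeros of all `L(s, χ)` (`χ` mod `q`), and
`x ≥ 2`: `|S(x; q, a, b) − x²/(2φ(q)²)| ≤ C x^{1+σ₁}` with an absolute constant `C`.
(Proof: `abs_S2_sub_le_final` divided by `φ(q)²`; the argument is the mean-square variant described in
the module docstring, not the printed explicit-formula proof.)
[cite: BhowmikHalupczokMatsumotoSuzuki2019, Theorem 1 (1)] -/
theorem BHMS2019_thm1_i_holds : BHMS2019_thm1_i := by
  obtain ⟨C, hC0, hC⟩ := abs_S2_sub_le_final
  refine ⟨C, ?_⟩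
  intro q _ a b ha hb σ₁ hσ₁ hZ x hx
  have ha' : IsUnit ((a : ZMod q)) := (ZMod.isUnit_iff_coprime a q).2 ha
  have hb' : IsUnit ((b : ZMod q)) := (ZMod.isUnit_iff_coprime b q).2 hb
  have hZ' : ResidueRiesz.ZerosRealPartLE q σ₁ := fun χ s h1 h2 h3 ↦ hZ χ s h1 h2 h3
  have h := hC q (a : ZMod q) (b : ZMod q) ha' hb' σ₁ hσ₁ hZ' x hx
  rw [S2_eq_totient_sq_mul] at h
  have hΦ : (0 : ℝ) < q.totient := by exact_mod_cast Nat.totient_pos.2 (NeZero.pos q)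
  have hΦ2 : (0 : ℝ) < (q.totient : ℝ) ^ 2 := by positivity
  have e : goldbachLambdaSumMod q a b x - (x : ℝ) ^ 2 / (2 * (q.totient : ℝ) ^ 2) =
      ((q.totient : ℝ) ^ 2 * goldbachLambdaSumMod q a b x - (x : ℝ) ^ 2 / 2) / (q.totient : ℝ) ^ 2 := by
    field_simp
  rw [e, abs_div, abs_of_pos hΦ2, div_le_iff₀ hΦ2]
  calc |(q.totient : ℝ) ^ 2 * goldbachLambdaSumMod q a b x - (x : ℝ) ^ 2 / 2|
      ≤ C * (q.totient : ℝ) ^ 2 * (x : ℝ) ^ (1 + σ₁) := h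
    _ = C * (x : ℝ) ^ (1 + σ₁) * (q.totient : ℝ) ^ 2 := by ring

end Literature.Barriers.Parity

end
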